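import Summits.Parity.BatemanHorn.Theses.SelbergDelangeRigidity
import Summits.Parity.BatemanHorn.Theorems.SystemLSDRealSegment.Negative.Structure

/-!
# `LSDRealSegment` — structure of the conclusion (what the real-segment law forces on `Λ`)

Structural facts about the conclusion of the crux
    `Summit.Parity.BatemanHorn.Theses.SelbergDelangeRigidity.LSDRealSegment`
(stmt-Parity-9770), from the standing disprover's work file `Cruxes/LSDRealSegment/Disproof.lean` §4, for any
family `f` and any `Λ` satisfying the segment law
`x⁻¹ e^{k(1-y) log log x} Σ_{n≤x} y^{Ω_f(n)} → Λ(y) e^{(y-1) log D} Γ(y)^{-k}` for real `y ∈ (5/4, 7/4)`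
(`Ω_f(n) = Σ_i Ω(f_i(n))`, `ArithmeticFunction.cardFactors`, un-capped):

* `omegaLaw_Λ_unique` — two such `Λ`'s holomorphic on `|z| < 2` coincide on the ball (no `∃`-slack; `Λ 0` is determined);
* `omegaLaw_update_zero` — WITHOUT holomorphy the clause `Λ 0 = C(f)` pins nothing;
* `omegaLaw_Λ_real_nonneg` — positivity passes to the limit: `Λ(y)` is real and `≥ 0` on the segment;
* `omegaLaw_Λ_real_on_diameter` — Schwarz symmetry: `Λ` is real on the whole diameter `(-2, 2)`.
(Same shape as the capped sibling `Theorems/SystemLSDRealSegment/Negative/Structure.lean`, whose generic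
`gammaFactor_ofReal`, `Λ_conj_symm` and engines are imported and reused.)
-/

open Filter Polynomial Finset
open scoped Topology

namespace Summit.Parity.BatemanHorn.Theorems.LSDRealSegment.Negative

open Summit.Parity.BatemanHorn.Theorems.SystemLSDRealSegment.Negative
open ArithmeticFunction (cardFactors)

/-- UNIQUENESS: two `Λ`'s holomorphic on `|z| < 2` satisfying the segment law for the same `(k, f)` coincide on
`ball 0 2` (limits are unique, the Γ-factor is non-zero, identity theorem). [folklore] -/
theorem omegaLaw_Λ_unique {k : ℕ} {f : Fin k → ℤ[X]} {Λ₁ Λ₂ : ℂ → ℂ}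
    (h₁ : DifferentiableOn ℂ Λ₁ (Metric.ball 0 2)) (h₂ : DifferentiableOn ℂ Λ₂ (Metric.ball 0 2))
    (l₁ : ∀ y : ℝ, 5 / 4 < y → y < 7 / 4 → Tendsto (fun x : ℕ => ((x : ℂ)⁻¹
        * Complex.exp ((k : ℂ) * (1 - (y : ℂ)) * (Real.log (Real.log x) : ℂ))
        * ∑ n ∈ Finset.range (x + 1), (y : ℂ) ^ (∑ i, cardFactors (((f i).eval (n : ℤ)).toNat))))
        atTop (𝓝 (Λ₁ y * (Complex.exp (((y : ℂ) - 1) *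
        (Real.log (∏ i, ((f i).natDegree : ℝ)) : ℂ)) * (Complex.Gamma y)⁻¹ ^ k))))
    (l₂ : ∀ y : ℝ, 5 / 4 < y → y < 7 / 4 → Tendsto (fun x : ℕ => ((x : ℂ)⁻¹
        * Complex.exp ((k : ℂ) * (1 - (y : ℂ)) * (Real.log (Real.log x) : ℂ))
        * ∑ n ∈ Finset.range (x + 1), (y : ℂ) ^ (∑ i, cardFactors (((f i).eval (n : ℤ)).toNat))))
        atTop (𝓝 (Λ₂ y * (Complex.exp (((y : ℂ) - 1) *
        (Real.log (∏ i, ((f i).natDegree : ℝ)) : ℂ)) * (Complex.Gamma y)⁻¹ ^ k)))) :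
    Set.EqOn Λ₁ Λ₂ (Metric.ball 0 2) := by
  refine eqOn_ball_of_eqOn_segment h₁ h₂ fun y hy hy' => ?_
  have := tendsto_nhds_unique (l₁ y hy hy') (l₂ y hy hy')
  exact mul_right_cancel₀ (gammaFactor_ne_zero k _ (by linarith)) this

/-- WITHOUT HOLOMORPHY THE `Λ 0`-CLAUSE IS VACUOUS: from any `Λ` satisfying the segment law and ANY `c`, the
function `update Λ 0 c` satisfies the same law and takes the value `c` at `0` (`0 ∉ (5/4, 7/4)`). So it is the
holomorphy of `Λ` on `ball 0 2` that makes `Λ 0 = batemanHornConst f` a genuine claim: the crux asserts that the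
ANALYTIC CONTINUATION of the real-segment law to `0` is the singular series. [folklore] -/
theorem omegaLaw_update_zero {k : ℕ} {f : Fin k → ℤ[X]} {Λ : ℂ → ℂ}
    (hlaw : ∀ y : ℝ, 5 / 4 < y → y < 7 / 4 →
      Tendsto (fun x : ℕ => ((x : ℂ)⁻¹
          * Complex.exp ((k : ℂ) * (1 - (y : ℂ)) * (Real.log (Real.log x) : ℂ))
          * ∑ n ∈ Finset.range (x + 1), (y : ℂ) ^ (∑ i, cardFactors (((f i).eval (n : ℤ)).toNat))))
          atTop (𝓝 (Λ y * (Complex.exp (((y : ℂ) - 1) *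
          (Real.log (∏ i, ((f i).natDegree : ℝ)) : ℂ)) * (Complex.Gamma y)⁻¹ ^ k)))) (c : ℂ) :
    Function.update Λ 0 c 0 = c ∧ ∀ y : ℝ, 5 / 4 < y → y < 7 / 4 →
      Tendsto (fun x : ℕ => ((x : ℂ)⁻¹
          * Complex.exp ((k : ℂ) * (1 - (y : ℂ)) * (Real.log (Real.log x) : ℂ))
          * ∑ n ∈ Finset.range (x + 1), (y : ℂ) ^ (∑ i, cardFactors (((f i).eval (n : ℤ)).toNat))))
          atTop (𝓝 (Function.update Λ 0 c y * (Complex.exp (((y : ℂ) - 1) *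
          (Real.log (∏ i, ((f i).natDegree : ℝ)) : ℂ)) * (Complex.Gamma y)⁻¹ ^ k))) := by
  refine ⟨Function.update_self .., fun y hy hy' => ?_⟩
  have hy0 : (y : ℂ) ≠ 0 := by exact_mod_cast (show y ≠ 0 by linarith)
  rw [Function.update_of_ne hy0]
  exact hlaw y hy hy'

/-- The complex normalised sum is a NON-NEGATIVE REAL number (positive weights). [folklore] -/
theorem omegaNormSum_ofReal_nonneg (k : ℕ) (f : Fin k → ℤ[X]) {y : ℝ} (hy : 0 ≤ y) (x : ℕ) :
    ∃ r : ℝ, 0 ≤ r ∧ ((x : ℂ)⁻¹ * Complex.exp ((k : ℂ) * (1 - (y : ℂ)) * (Real.log (Real.log x) : ℂ))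
        * ∑ n ∈ Finset.range (x + 1), (y : ℂ) ^ (∑ i, cardFactors (((f i).eval (n : ℤ)).toNat))) = (r : ℂ) := by
  refine ⟨(x : ℝ)⁻¹ * Real.exp (k * (1 - y) * Real.log (Real.log x)) * ∑ n ∈ Finset.range (x + 1), y
      ^ (∑ i, cardFactors (((f i).eval (n : ℤ)).toNat)), ?_, ?_⟩
  · have : 0 ≤ ∑ n ∈ Finset.range (x + 1), y ^ (∑ i, cardFactors (((f i).eval (n : ℤ)).toNat)) :=
      Finset.sum_nonneg fun _ _ => pow_nonneg hy _
    positivity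
  · push_cast
    rfl

/-- POSITIVITY PASSES TO THE LIMIT: the segment law forces `Λ(y)` to be REAL and `≥ 0` at every
`y ∈ (5/4, 7/4)`. [folklore] -/
theorem omegaLaw_Λ_real_nonneg {k : ℕ} {f : Fin k → ℤ[X]} {Λ : ℂ → ℂ}
    (hlaw : ∀ y : ℝ, 5 / 4 < y → y < 7 / 4 →
      Tendsto (fun x : ℕ => ((x : ℂ)⁻¹
          * Complex.exp ((k : ℂ) * (1 - (y : ℂ)) * (Real.log (Real.log x) : ℂ))
          * ∑ n ∈ Finset.range (x + 1), (y : ℂ) ^ (∑ i, cardFactors (((f i).eval (n : ℤ)).toNat))))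
          atTop (𝓝 (Λ y * (Complex.exp (((y : ℂ) - 1) *
          (Real.log (∏ i, ((f i).natDegree : ℝ)) : ℂ)) * (Complex.Gamma y)⁻¹ ^ k))))
    {y : ℝ} (hy : 5 / 4 < y) (hy' : y < 7 / 4) : (Λ y).im = 0 ∧ 0 ≤ (Λ y).re := by
  obtain ⟨e, he, hE⟩ := gammaFactor_ofReal k f (by linarith : (0 : ℝ) < y)
  have hlim := hlaw y hy hy'
  rw [hE] at hlim
  choose r hr0 hr using fun x => omegaNormSum_ofReal_nonneg k f (by linarith : (0 : ℝ) ≤ y) x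
  have hlim' : Tendsto (fun x : ℕ => ((r x : ℝ) : ℂ)) atTop (𝓝 (Λ y * e)) := hlim.congr hr
  have hre : Tendsto r atTop (𝓝 (Λ y * e).re) := tendsto_re_of_tendsto_ofReal hlim'
  have him : (Λ y * e).im = 0 := by
    have h1 := (Complex.continuous_im.tendsto _).comp hlim'
    have h2 : Tendsto (fun x : ℕ => (((r x : ℝ) : ℂ)).im) atTop (𝓝 0) := by simp
    exact tendsto_nhds_unique h1 h2
  have hre0 : 0 ≤ (Λ y * e).re := ge_of_tendsto' hre hr0
  rw [Complex.mul_im, Complex.ofReal_re, Complex.ofReal_im, mul_zero, zero_add] at him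
  rw [Complex.mul_re, Complex.ofReal_re, Complex.ofReal_im, mul_zero, sub_zero] at hre0
  exact ⟨(mul_eq_zero.1 him).resolve_right he.ne', (mul_nonneg_iff_of_pos_right he).1 hre0⟩

/-- Consequence: under the segment law, a `Λ` holomorphic on `|z| < 2` is REAL at every real `t ∈ (-2, 2)` — in
particular the pinned value `Λ 0` is real, as `batemanHornConst f` is, and so are all Taylor coefficients of `Λ`
at `0` (the data the route extracts). [folklore] -/
theorem omegaLaw_Λ_real_on_diameter {k : ℕ} {f : Fin k → ℤ[X]} {Λ : ℂ → ℂ} (hΛ : DifferentiableOn ℂ Λ (Metric.ball 0 2))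
    (hlaw : ∀ y : ℝ, 5 / 4 < y → y < 7 / 4 →
      Tendsto (fun x : ℕ => ((x : ℂ)⁻¹
          * Complex.exp ((k : ℂ) * (1 - (y : ℂ)) * (Real.log (Real.log x) : ℂ))
          * ∑ n ∈ Finset.range (x + 1), (y : ℂ) ^ (∑ i, cardFactors (((f i).eval (n : ℤ)).toNat))))
          atTop (𝓝 (Λ y * (Complex.exp (((y : ℂ) - 1) *
          (Real.log (∏ i, ((f i).natDegree : ℝ)) : ℂ)) * (Complex.Gamma y)⁻¹ ^ k))))
    {t : ℝ} (ht : |t| < 2) : (Λ t).im = 0 := by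
  have hsym := Λ_conj_symm hΛ fun y hy hy' => (omegaLaw_Λ_real_nonneg hlaw hy hy').1
  have hmem : ((t : ℝ) : ℂ) ∈ Metric.ball (0 : ℂ) 2 := by
    simpa [Metric.mem_ball, dist_zero_right, Complex.norm_real] using ht
  have := hsym hmem
  simp only [Complex.conj_ofReal] at this
  exact Complex.conj_eq_iff_im.1 this.symm

/-- Certificate: the segment law above is the one of the route decl (its conclusion, third conjunct, with the
limit re-associated). -/
example (k : ℕ) (f : Fin k → ℤ[X]) (Λ : ℂ → ℂ) (y : ℝ) :
    (Tendsto (fun x : ℕ => ((x : ℂ)⁻¹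
        * Complex.exp ((k : ℂ) * (1 - (y : ℂ)) * (Real.log (Real.log x) : ℂ))
        * ∑ n ∈ Finset.range (x + 1), (y : ℂ) ^ (∑ i, cardFactors (((f i).eval (n : ℤ)).toNat))))
        atTop (𝓝 (Λ y * (Complex.exp (((y : ℂ) - 1) *
        (Real.log (∏ i, ((f i).natDegree : ℝ)) : ℂ)) * (Complex.Gamma y)⁻¹ ^ k)))) ↔
      Filter.Tendsto (fun x : ℕ => (x : ℂ)⁻¹ * Complex.exp ((k : ℂ) * (1 - (y : ℂ)) * (Real.log (Real.log x) : ℂ)) *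
        ∑ n ∈ Finset.range (x + 1), (y : ℂ) ^ (∑ i, ArithmeticFunction.cardFactors (((f i).eval (n : ℤ)).toNat)))
        Filter.atTop (nhds (Λ y * Complex.exp (((y : ℂ) - 1) * (Real.log (∏ i, ((f i).natDegree : ℝ)) : ℂ)) *
          (Complex.Gamma y)⁻¹ ^ k)) := by
  rw [mul_assoc]

end Summit.Parity.BatemanHorn.Theorems.LSDRealSegment.Negative
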